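import Summits.ValiantsHypothesis.ValiantsHypothesis.Theses.ValuativeGCT
import Literature.NumberTheory.DiophantineGeometry.SchurWeylPlethysmKroneckerBoundProofs
import Literature.Computability.AlgebraicComplexity.GCTObstructionsWeightForm
import Literature.Computability.AlgebraicComplexity.MultiplicityObstructionsProofs
import HarnessLib.Audit

/-!
# Line `hwtopoly-density-transport` — skeleton for crux `ValuativeGCT.ValuativeBound`
(item stmt-ValiantsHypothesis-12625, route route-ValiantsHypothesis-ValuativeGCT)

Idea (card `Cruxes/ValuativeBound/Ideas/hwtopoly-density-transport.md`): the End-orbit pull-back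
`Φ : ℂ[Δ(det_m)] ↪ ℂ[End W]` needed by the crux already exists in the tree, injective, as
`orbitCoordToPoly f m` / `hwToPoly f m χ` (`SchurWeylPlethysmKroneckerBoundProofs` §1, the file that
proves the `U = 0` shadow `orbitMultiplicity_det_le_kroneckerCoeff_holds`). The valuative truncation
`T_U(λ)` of the crux is, clause by clause, a description of the IMAGE of `hwToPoly`:

* degree `m δ` — tree: `isHomogeneous_orbitCoordToPoly` + `size_toMatIdx_dualOfPartition`
  (consumes the guard `lam.parts.card ≤ m * m`; no stub);
* Borel clause `P(g⁻¹ A) = χ(g) P(A)` as a POLYNOMIAL identity — `stub_borelClause`: the tree proves it at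
  invertible `A` (`eval_orbitCoordToPoly_mul_left`), and `GL` is Zariski dense in `End`
  (`MvPolynomial.eq_of_eval_eq_on_gl`);
* stabiliser clause `P(A M) = P(A)` for EVERY matrix `M` with `M · det_m = det_m`, singular or not —
  `stub_stabClause`: right functoriality of the generic orbit map (`eval_genericOrbitMap`, `linSubst_mul`,
  `MvPolynomial.funext`);
* vanishing clause `P ∈ I(L_U)^(δ(m-r))` — `stub_powTransport` (a weight of size `-m D` pins a degree-`D`
  homogeneous representative, `mem_orbitCoordRingDeg_of_mem_highestWeightSpace`, so `Φ` maps the class into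
  `J^D` as soon as every generic coefficient `Φ(X_d)` lies in `J`) fed with the route's support item
  `ValuativeGCT.CoeffVanishingOrder` (stmt-ValiantsHypothesis-12628: `Φ(X_d) ∈ I(L_U)^(m-r)`), taken as a
  named hypothesis of `ValuativeBound_of`.

Then `range (hwToPoly det_m m λ*) ≤ T`, `T ≤ Hom_{mδ}` is finite-dimensional, and
`orbitMultiplicity = finrank HW_{λ*} = finrank (range hwToPoly) ≤ finrank T`
(`orbitMultiplicity_le_finrank_of_range_le`, sorry-free).

Disproof.lean obligations honoured (cdisprove cycle 1, evidence notes on stmt-12625):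
`valuativeBound_false_without_rank` — the rank hypothesis `hU` is used (only) through
`CoeffVanishingOrder` in the vanishing clause; `valuativeBound_false_without_card` — the guard
`lam.parts.card ≤ m*m` is used in the degree clause AND in `stub_powTransport` (size of the weight);
`not_valuativeBoundSharperThreshold` / `coeffVanishingOrder_false_with_exponent_succ` — the exponent is
exactly `δ * (m - r)` = `(m - r)` per coefficient, never more; `coeffVanishingOrder_false_with_columns` —
the ROW convention of `L_U` is the route's, untouched.

`lean check`: sorries only in `stub_borelClause`, `stub_stabClause`, `stub_powTransport`;
`ValuativeBound_of : CoeffVanishingOrder → ValuativeBound` is sorry-free glue over the three stubs.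

CERTIFICATION (planner scratch `StubProofs.lean`, attached as evidence on stmt-12625 and published as the
crux workfile `HwtopolyDensityTransportStubProofs.lean`, lean check rc 0, 0 sorry, axioms
{propext, Classical.choice, Quot.sound} for `valuativeBound_of_coeffVanishingOrder`): all three stubs have
complete candidate proofs — reproduced below each `sorry` as a comment (helper `eval_aeval_subst`,
`prod_pow_mem_pow_sum` included) — so along this line the crux is CLOSED MODULO the support item
stmt-ValiantsHypothesis-12628 (`CoeffVanishingOrder`). The stubs stay `sorry` here on purpose: the protocol
registers sorried stubs; a prover lands them with `propose --supports stmt-ValiantsHypothesis-12625`.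
-/

open MvPolynomial
open scoped BigOperators Matrix
open Literature.NumberTheory.DiophantineGeometry Literature.Computability.AlgebraicComplexity

namespace Summit.ValiantsHypothesis.ValiantsHypothesis.Cruxes.ValuativeBound.HwtopolyDensityTransport

/-! ## Stubs (the three open lemmas of the line) -/

/-- **Stub 1 — Borel clause as a polynomial identity (the density lever).** For a highest-weight class
`x` of weight `χ` in `ℂ[Δ_m[f]]` and an upper triangular `g`, the polynomial `P = hwToPoly f m χ x` on
matrix space satisfies `P(g⁻¹ A) = χ(g) · P(A)` identically in `A ∈ End`, i.e. the substitution
`X (j,i) ↦ ∑ l, (g⁻¹) j l • X (l,i)` multiplies `P` by `weightChar χ g`.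
Plan: `MvPolynomial.eq_of_eval_eq_on_gl`; at invertible `g'` the left side evaluates to
`eval (entries of g⁻¹ * g') P` (`eval₂`/`bind₁` composition, `Matrix.mul_apply`), which is
`(weightChar χ g⁻¹)⁻¹ * eval g' P` by `eval_orbitCoordToPoly_mul_left` (with `b := g⁻¹`,
`(borelSubgroup _ _).inv_mem hg`) and `weightChar_inv`, `inv_inv`; the right side is `smul_eval`.
Size S/M (~30 lines). -/
theorem stub_borelClause {σ : Type*} [Fintype σ] [LinearOrder σ]
    (f : MvPolynomial σ ℂ) (m : ℕ) (χ : Weight σ)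
    (x : ↥(highestWeightSpace (orbitCoordRep f m) χ))
    (g : GL σ ℂ) (hg : IsUpperTriangular g) :
    MvPolynomial.aeval
        (fun p : σ × σ => ∑ l : σ, ((g⁻¹ : GL σ ℂ) : Matrix σ σ ℂ) p.1 l • MvPolynomial.X (l, p.2))
        (hwToPoly f m χ x) = weightChar χ g • hwToPoly f m χ x := by
  sorry
  /- candidate proof (planner scratch StubProofs.lean `borelClause`, rc 0), with the helper
       theorem eval_aeval_subst (s : σ × σ → MvPolynomial (σ × σ) ℂ) (x : σ × σ → ℂ)
           (P : MvPolynomial (σ × σ) ℂ) : eval x (aeval s P) = eval (fun i => eval x (s i)) P := by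
         rw [aeval_eq_bind₁]; show eval₂Hom (RingHom.id ℂ) x (bind₁ s P) = _; rw [eval₂Hom_bind₁]; rfl
     :
  obtain ⟨F, hF⟩ := Ideal.Quotient.mk_surjective (x : OrbitCoordRing f m)
  have hx : Ideal.Quotient.mk (orbitVanishingIdeal f m) F ∈ highestWeightSpace (orbitCoordRep f m) χ := by
    rw [hF]; exact x.2
  rw [hwToPoly_apply, ← hF]
  apply MvPolynomial.eq_of_eval_eq_on_gl
  intro g'
  rw [eval_aeval_subst, smul_eval]
  have hpt : (fun i : σ × σ => eval (fun ij : σ × σ => (g' : Matrix σ σ ℂ) ij.1 ij.2)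
      (∑ l : σ, ((g⁻¹ : GL σ ℂ) : Matrix σ σ ℂ) i.1 l • MvPolynomial.X (l, i.2))) =
      fun ij : σ × σ => (((g⁻¹ : GL σ ℂ) : Matrix σ σ ℂ) * (g' : Matrix σ σ ℂ)) ij.1 ij.2 := by
    funext ij
    simp [map_sum, smul_eval, eval_X, Matrix.mul_apply]
  rw [hpt, eval_orbitCoordToPoly_mul_left f m hx ((borelSubgroup σ ℂ).inv_mem hg) g',
    weightChar_inv χ hg, inv_inv]
  -/

/-- **Stub 2 — stabiliser clause for ALL stabilising matrices (right functoriality of the generic orbit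
map).** If `M · f = f` (`linSubst σ ℂ M f = f`, `M` invertible or not) then the generic orbit map of any
`F` is invariant under `A ↦ A M`, i.e. under the substitution `X (j,i) ↦ ∑ l, M l i • X (j,l)`.
Plan: `MvPolynomial.funext` (ℂ infinite); at a point `A`, the left side is
`eval (entries of A * M) (genericOrbitMap f m F)` (`eval_bind₁`/`aeval` composition, `Matrix.mul_apply`),
`= aeval (formCoeff m (linSubst (A * M) f)) F` (`eval_genericOrbitMap`)
`= aeval (formCoeff m (linSubst A (linSubst M f))) F` (`linSubst_mul`) `= eval A (genericOrbitMap f m F)` by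
`hM`. Size S/M (~25 lines). -/
theorem stub_stabClause {σ : Type*} [Fintype σ] [LinearOrder σ]
    (f : MvPolynomial σ ℂ) (m : ℕ) (F : MvPolynomial (DegIdx σ m) ℂ)
    (M : Matrix σ σ ℂ) (hM : linSubst σ ℂ M f = f) :
    MvPolynomial.aeval (fun p : σ × σ => ∑ l : σ, M l p.2 • MvPolynomial.X (p.1, l))
        (genericOrbitMap f m F) = genericOrbitMap f m F := by
  sorry
  /- candidate proof (planner scratch StubProofs.lean `stabClause`, rc 0; `eval_aeval_subst` as above):
  apply MvPolynomial.funext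
  intro A
  rw [eval_aeval_subst]
  set A' : Matrix σ σ ℂ := Matrix.of fun i j => A (i, j) with hA'
  have hA : (fun ij : σ × σ => A' ij.1 ij.2) = A := by
    funext ij; rw [hA', Matrix.of_apply]
  have hpt : (fun i : σ × σ => eval A (∑ l : σ, M l i.2 • MvPolynomial.X (i.1, l))) =
      fun ij : σ × σ => (A' * M) ij.1 ij.2 := by
    funext ij
    simp [map_sum, smul_eval, eval_X, Matrix.mul_apply, hA', mul_comm]
  rw [hpt, eval_genericOrbitMap, linSubst_mul, AlgHom.comp_apply, hM, ← eval_genericOrbitMap, hA]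
  -/

/-- **Stub 3 — transport of ideal powers along the pull-back (the vanishing clause, abstract form).**
For `m ≠ 0` and a weight `χ` of size `-(m D)`, a highest-weight class `x` of weight `χ` in `ℂ[Δ_m[f]]`
has a representative `F` homogeneous of degree `D` (`mem_orbitCoordRingDeg_of_mem_highestWeightSpace`:
the torus part of weight `χ` of any representative), so `hwToPoly f m χ x = genericOrbitMap f m F`
(`orbitCoordToPoly_mk`) is a `ℂ`-combination of products of `D` generic coefficients
`genericOrbitMap f m (X d)`; if each of these lies in an ideal `J`, the image lies in `J ^ D`
(`Ideal.pow_mem_pow`, `Ideal.mul_mem_mul`, `pow_add`, `Finsupp.degree`). Applied with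
`J = I(L_U)^(m-r)` and `D = δ` this is the valuative clause of `T_U(λ)`. Size M (~45 lines). -/
theorem stub_powTransport {σ : Type*} [Fintype σ] [LinearOrder σ]
    (f : MvPolynomial σ ℂ) {m D : ℕ} (hm : m ≠ 0) (χ : Weight σ)
    (hχ : χ.size = -((m * D : ℕ) : ℤ))
    (x : ↥(highestWeightSpace (orbitCoordRep f m) χ))
    (J : Ideal (MvPolynomial (σ × σ) ℂ))
    (hJ : ∀ d : DegIdx σ m, genericOrbitMap f m (MvPolynomial.X d) ∈ J) :
    hwToPoly f m χ x ∈ J ^ D := by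
  sorry
  /- candidate proof (planner scratch StubProofs.lean `powTransport`, rc 0), with the helper
       theorem prod_pow_mem_pow_sum {R ι : Type*} [CommRing R] (t : Finset ι) (c : ι → R) (e : ι → ℕ)
           (J : Ideal R) (hc : ∀ i ∈ t, c i ∈ J) : ∏ i ∈ t, c i ^ e i ∈ J ^ (∑ i ∈ t, e i) := by
         classical
         induction t using Finset.induction_on with
         | empty => simp
         | insert a t ha ih =>
           rw [Finset.prod_insert ha, Finset.sum_insert ha, pow_add]
           exact Ideal.mul_mem_mul (Ideal.pow_mem_pow (hc a (Finset.mem_insert_self a t)) _)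
             (ih fun i hi => hc i (Finset.mem_insert_of_mem hi))
     :
  classical
  obtain ⟨F, hFD, hF⟩ := mem_orbitCoordRingDeg_iff.mp
    (mem_orbitCoordRingDeg_of_mem_highestWeightSpace f hm hχ x.2)
  rw [hwToPoly_apply, ← hF, orbitCoordToPoly_mk]
  set c : DegIdx σ m → MvPolynomial (σ × σ) ℂ := fun d => coeff d.1
    (linSubst σ (MvPolynomial (σ × σ) ℂ) (Matrix.mvPolynomialX σ σ ℂ)
      (map (C : ℂ →+* MvPolynomial (σ × σ) ℂ) f)) with hc
  have hgen : genericOrbitMap f m = aeval c := rfl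
  have hcJ : ∀ d, c d ∈ J := fun d => by
    have h := hJ d
    rwa [hgen, aeval_X] at h
  rw [F.as_sum, map_sum]
  refine Ideal.sum_mem _ fun s hs => ?_
  rw [hgen, aeval_monomial, Finsupp.prod]
  refine Ideal.mul_mem_left _ _ ?_
  rw [hFD.degree_eq_sum_deg_support hs]
  exact prod_pow_mem_pow_sum _ _ _ J fun d _ => hcJ d
  -/

/-! ## Glue (sorry-free) -/

/-- `K = finrank HW_χ = finrank (range hwToPoly) ≤ finrank T` for any `T ≤ Hom_n` containing the range of the
injective `hwToPoly` (`hwToPoly_injective`, `LinearMap.finrank_range_of_inj`, `Submodule.finrank_mono`;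
`Hom_n` is finite-dimensional, `finite_homogeneousSubmodule`). BLMW 2011 §5.2 template
(`finrank_highestWeightSpace_orbitCoordRep_le`). -/
theorem orbitMultiplicity_le_finrank_of_range_le {m : ℕ} {χ : Weight (MatIdx m)} {n : ℕ}
    {T : Submodule ℂ (MvPolynomial (MatIdx m × MatIdx m) ℂ)}
    (hT : T ≤ homogeneousSubmodule (MatIdx m × MatIdx m) ℂ n)
    (h : LinearMap.range (hwToPoly (detFormLex ℂ m) m χ) ≤ T) :
    orbitMultiplicity ℂ (detFormLex ℂ m) m χ ≤ Module.finrank ℂ T := by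
  haveI : Module.Finite ℂ (homogeneousSubmodule (MatIdx m × MatIdx m) ℂ n) :=
    finite_homogeneousSubmodule _ _ _
  haveI : Module.Finite ℂ T := Submodule.finiteDimensional_of_le hT
  calc orbitMultiplicity ℂ (detFormLex ℂ m) m χ
      = Module.finrank ℂ (highestWeightSpace (orbitCoordRep (detFormLex ℂ m) m) χ) := rfl
    _ = Module.finrank ℂ (LinearMap.range (hwToPoly (detFormLex ℂ m) m χ)) :=
        (LinearMap.finrank_range_of_inj (hwToPoly_injective _ _ _)).symm
    _ ≤ Module.finrank ℂ T := Submodule.finrank_mono h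

/-- **The composition** (concludes the crux BY NAME): the three stubs and the route's support item
`CoeffVanishingOrder` (stmt-ValiantsHypothesis-12628, hypothesis by name) give
`range (hwToPoly det_m m λ*) ≤ T_U(λ)`, hence `K_m(λ) ≤ dim T_U(λ)`. -/
theorem ValuativeBound_of
    (hC : Summit.ValiantsHypothesis.ValiantsHypothesis.Theses.ValuativeGCT.CoeffVanishingOrder) :
    Summit.ValiantsHypothesis.ValiantsHypothesis.Theses.ValuativeGCT.ValuativeBound := by
  intro m _ U r hU δ lam hlam χ T
  refine orbitMultiplicity_le_finrank_of_range_le (n := m * δ)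
    (inf_le_left.trans (inf_le_left.trans inf_le_left)) ?_
  rintro _ ⟨x, rfl⟩
  -- a representative of the class
  obtain ⟨F, hF⟩ := Ideal.Quotient.mk_surjective (x : OrbitCoordRing (detFormLex ℂ m) m)
  have hx : Ideal.Quotient.mk (orbitVanishingIdeal (detFormLex ℂ m) m) F ∈
      highestWeightSpace (orbitCoordRep (detFormLex ℂ m) m) χ := by
    rw [hF]; exact x.2
  have hP : hwToPoly (detFormLex ℂ m) m χ x = genericOrbitMap (detFormLex ℂ m) m F := by
    rw [hwToPoly_apply, ← hF, orbitCoordToPoly_mk]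
  have hsize : χ.size = -((m * δ : ℕ) : ℤ) := size_toMatIdx_dualOfPartition m lam hlam
  -- (i) degree clause: tree
  have hdeg : (hwToPoly (detFormLex ℂ m) m χ x).IsHomogeneous (m * δ) := by
    rw [hwToPoly_apply, ← hF]
    exact isHomogeneous_orbitCoordToPoly _ _ hx hsize
  -- (iv) vanishing clause: stub 3 + CoeffVanishingOrder
  have hvan : hwToPoly (detFormLex ℂ m) m χ x ∈
      (MvPolynomial.vanishingIdeal ℂ
        {p : MatIdx m × MatIdx m → ℂ | ∀ j : MatIdx m, (fun i => p (j, i)) ∈ U}) ^ (δ * (m - r)) := by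
    rw [mul_comm δ (m - r), pow_mul]
    exact stub_powTransport (detFormLex ℂ m) (NeZero.ne m) χ hsize x _ fun d => hC m U r hU d
  refine Submodule.mem_inf.mpr ⟨Submodule.mem_inf.mpr ⟨Submodule.mem_inf.mpr ⟨?_, ?_⟩, ?_⟩, ?_⟩
  · exact (mem_homogeneousSubmodule _ _).mpr hdeg
  · exact (Submodule.restrictScalars_mem ℂ _ _).mpr hvan
  · -- (iii) stabiliser clause: stub 2
    refine (Submodule.mem_iInf _).mpr fun M => (Submodule.mem_iInf _).mpr fun hM => ?_
    rw [LinearMap.mem_ker, LinearMap.sub_apply, LinearMap.id_apply, AlgHom.toLinearMap_apply,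
      sub_eq_zero, hP]
    exact stub_stabClause (detFormLex ℂ m) m F M hM
  · -- (ii) Borel clause: stub 1
    refine (Submodule.mem_iInf _).mpr fun g => (Submodule.mem_iInf _).mpr fun hg => ?_
    rw [LinearMap.mem_ker, LinearMap.sub_apply, LinearMap.smul_apply, LinearMap.id_apply,
      AlgHom.toLinearMap_apply, sub_eq_zero]
    exact stub_borelClause (detFormLex ℂ m) m χ x g hg

end Summit.ValiantsHypothesis.ValiantsHypothesis.Cruxes.ValuativeBound.HwtopolyDensityTransport
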